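import Summits.BirchSwinnertonDyer.BirchSwinnertonDyer.Theorems.BiquadraticEisensteinDescentDeuringRowEightThousand
import HarnessLib

set_option linter.dupNamespace false -- `Summit.BirchSwinnertonDyer.BirchSwinnertonDyer.Theorems.…` (summit = sub)
set_option autoImplicit false

/-!
# BED route, «Deuring-ψ lane»: ideal Größencharakter datum with a SET of bad primes ⇒ CORE (consumer interface for the rows `j = 1728`, `j = 0`)

Route `BiquadraticEisensteinDescent` of `Summits/BirchSwinnertonDyer` (crux `EisensteinHeartFlatCMInertBadKPrime`, stmt-BirchSwinnertonDyer-21341;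
cell `bsd-wall`, seat w4 g17). THEOREMS ONLY. The multi-bad-prime twin of `core_of_datum` (`…DeuringRowEightThousand`): the datum
provider supplies an ideal Größencharakter `ψ₀ mod 𝔣` of type `(1,0)`, RAMIFICATION of `heckeOfGross ψ₀` at every place over a bad prime of
`W` (e.g. by the unit-witness criterion `not_isUnramifiedAt_heckeOfGross_of_ne`, as in `QuarticTwistDatum.not_isUnramifiedAt_gen`), `a_p(W) = 0`
at the bad primes, and Deuring's split / inert values at the good primes (which must be unramified in `K`); the conclusion is the CORE
`∃ ψ` of type `(1,0)` with `L(s, ψ) = L(W, s)` on `re s > 3/2`, to be fed to `deuring_of_core_at`.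

* ★ `core_of_datum_set` (the one-prime case is `core_of_datum` of `…DeuringRowEightThousand`).

BSD is not proved by any of this. References: [SilvermanATAEC1994] II Thm. 9.2, Thm. 10.5; [NeukirchANT1999] VII (6.14).
-/

noncomputable section

open scoped Classical NumberField NumberTheorySymbols ComplexConjugate
open NumberField IsDedekindDomain WeierstrassCurve Rat.HeightOneSpectrum
  Literature.NumberTheory.GaloisRepresentations
  Literature.NumberTheory.EllipticCurves
  Literature.NumberTheory.QuadraticFields
open Literature.NumberTheory.LFunctions (idealPow)

namespace Summit.BirchSwinnertonDyer.BirchSwinnertonDyer.Theorems.BiquadraticEisensteinDescentDeuringOfCore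

variable {K : Type} [Field K] [NumberField K]

/-- ★ **Ideal Größencharakter datum with a set of bad primes ⇒ the CORE of Deuring's theorem.** Let `K` be imaginary quadratic, `c ≠ 1`,
`ψ₀` a Größencharakter `mod 𝔣 ≠ 0` of type `(1, 0)` and `ψ = heckeOfGross ψ₀`; let `W/ℚ` be elliptic such that (bad primes) for every
`p ∣ N_W`: `a_p(W) = 0` and `ψ` is ramified at every place over `p`; (good primes) for every `p ∤ N_W`: `p ∤ d_K` and at every `𝔭 ∋ p`:
`𝔣 ∤ 𝔭`, split `ψ₀(𝔭) + ψ₀(c𝔭) = a_p(W)`, `ψ₀(𝔭)ψ₀(c𝔭) = p`, inert `a_p(W) = 0`, `ψ₀(𝔭) = −p`. Then `ψ` has type `(1,0)` and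
`L(s, ψ) = L(W, s)` on `re s > 3/2`. [cite: SilvermanATAEC1994, Ch. II Thm. 9.2 (a), Thm. 10.5 (b)] [cite: NeukirchANT1999, Ch. VII §6 Cor. (6.14)] -/
theorem core_of_datum_set (W : WeierstrassCurve ℚ) [W.IsElliptic] [IsTotallyComplex K] (h2 : Module.finrank ℚ K = 2)
    {c : K ≃ₐ[ℚ] K} (hc : c ≠ 1) {𝔣 : Ideal (𝓞 K)} {ψ₀ : HeightOneSpectrum (𝓞 K) → ℂ} (h𝔣 : 𝔣 ≠ ⊥)
    (hψ₀ : IsGrossencharakter 𝔣 (fun _ ↦ 1) (fun _ ↦ 0) ψ₀)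
    (hbad : ∀ p : ℕ, p.Prime → p ∣ W.conductorNorm ℤ →
      W.LFunction p = 0 ∧ ∀ w : HeightOneSpectrum (𝓞 K), (p : 𝓞 K) ∈ w.asIdeal → ¬ (heckeOfGross h𝔣 hψ₀).IsUnramifiedAt w)
    (hgood : ∀ p : ℕ, p.Prime → ¬ p ∣ W.conductorNorm ℤ →
      ¬ (p : ℤ) ∣ NumberField.discr K ∧ ∀ w : HeightOneSpectrum (𝓞 K), (p : 𝓞 K) ∈ w.asIdeal →
        ¬ 𝔣 ≤ w.asIdeal ∧
        (c • w ≠ w → ψ₀ w + ψ₀ (c • w) = ((W.LFunction p : ℤ) : ℂ) ∧ ψ₀ w * ψ₀ (c • w) = p) ∧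
        (c • w = w → W.LFunction p = 0 ∧ ψ₀ w = -(p : ℂ))) :
    ∃ ψ : HeckeCharacter K, ψ.HasInfinityType (fun _ ↦ 1) (fun _ ↦ 0) ∧
      ∀ s : ℂ, 3 / 2 < s.re → heckeLFunction ψ s = W.LSeries s := by
  refine ⟨heckeOfGross h𝔣 hψ₀, heckeOfGross_hasInfinityType h𝔣 hψ₀, fun s hs ↦
    heckeLFunction_eq_LSeries_of_frobenius h2 hc (heckeOfGross_hasInfinityType h𝔣 hψ₀) W hbad ?_ hs⟩
  intro p hp hpN w hw
  obtain ⟨hnd, hall⟩ := hgood p hp hpN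
  obtain ⟨hv', hsplit, hinert⟩ := hall w hw
  have hcw : (p : 𝓞 K) ∈ (c • w).asIdeal := (OmegaPrime.natCast_mem_smul_asIdeal_iff c w p).mpr hw
  obtain ⟨hcv', -, -⟩ := hall (c • w) hcw
  rw [heckeOfGross_valueAtUniformizer h𝔣 hψ₀ hv', heckeOfGross_valueAtUniformizer h𝔣 hψ₀ hcv']
  exact ⟨heckeOfGross_isUnramifiedAt h𝔣 hψ₀ hv', GrossCurve.ramificationIdx_eq_one_of_natCast_mem h2 hp hnd hw, hsplit, hinert⟩

end Summit.BirchSwinnertonDyer.BirchSwinnertonDyer.Theorems.BiquadraticEisensteinDescentDeuringOfCore
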